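import Summits.QuantumFields.BalabanUV.Beta.FP.SymmetryK
import Summits.QuantumFields.BalabanUV.Beta.GAN24.CombesThomas

/-!
# `BalabanUV.Beta.FP.SymmetryKSlot` — road «FP» for binder row D1, leaf N3(ii)-K at `m = 1` FROM ROW G-an2-4's K-SLOT BY NAME: the three
# kernel-side binders (`hKd`, `hKs`, `hKr`) of every K-generic reflection END at the perfect ONE-STEP resolvent `KPerf Lc sf sm 1`, blocking `Lc`,
# with the X1m-K input of `FP.SymmetryK.kernelSide_KPerf` DISCHARGED from gan24's (CONV-C) K-slot predicates `UnitDecayK` / `CauchyDecayK`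
# (`GAN24.CombesThomas`) — at `m = 1` the (j, 1)-resolvent IS the step resolvent `KInvStep Lc j` (`FP.PerfectObjects.KInvStep_eq_KTot`, `rfl`)

HONEST FRAMING (cell contract, verbatim): «discharging `BetaPertH` makes Bałaban's UV stability UNCONDITIONAL — a real constructive-QFT
result; it is NOT the continuum limit and NOT the Clay problem.»  THIS MODULE DISCHARGES NOTHING of the wall: the K-slot predicates of row
G-an2-4 (`UnitDecayK`, `CauchyDecayK`, `ConvCKWall` — «NOT IN PRINT; our proof target; asserted nowhere») enter as HYPOTHESES; the file only
shows that at `m = 1` they are EXACTLY the X1m-K input of `SymmetryK` (no (j, m)-family convergence beyond (CONV-C) is needed for the perfect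
ONE-step resolvent).  Claim table `HOME/b2b-balaban-beta-d1-p3/LEAVES-FP.md` row N3(ii)–(iv), sub-row N3(ii)-K (unit `b2b-balaban-beta-d1-formalise-leaf-06`).
NOT BetaPertH, NOT continuum, NOT Clay.
ABSOLUTE RULE (cell, verbatim): «No internally-minted statement may enter as a cited fact. Every hypothesis is either kernel-proved in this
package or a verbatim quotation of a PUBLISHED theorem with page reference.»  Nothing is cited; no `def … : Prop`; no binder instantiated at a value.

CONTENT (all [our object]; any `d`, any `Lc ≥ 1`, any unit sequences unless stated).
* `exists_tendsto_of_cauchyDecayK` — `CauchyDecayK d Lc sf sm cK θ δ` with `θ < 1` ⟹ every entry of `j ↦ unitK (sf j) (sm j) (KTot (Lc^(j+1)) (Lc^j))`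
  converges (X1m-K at `m = 1`);
* **`shiftK_KPerf_one`** (0 hypotheses, blocking written `Lc`), **`refK_KPerf_one_of_cauchyDecayK`**, **`decays_KPerf_one_of_KSlot`**,
  **`kernelSide_KPerf_one_of_KSlot`** — `(hKd, hKs, hKr)` at `K := KPerf Lc sf sm 1`, `N := Lc` from `UnitDecayK` + `CauchyDecayK` + `0 < δ`, `θ < 1`;
* **`kernelSide_KPerf_one_of_convCKWall`** — the same from the ∃-packaged wall form `ConvCKWall d Lc` in the adopted units `(sfStep Lc, smStep d Lc)`.
-/

namespace Summit.QuantumFields.BalabanUV.Beta.FP.SymmetryKSlot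

open Filter Topology
open Literature.MathematicalPhysics.QuantumFieldTheory.Balaban1983to89
open Literature.MathematicalPhysics.QuantumFieldTheory.Balaban1983to89.Beta
open ExpKernelCalculus (MKer Decays shiftK)
open KernelReflection (refK)
open ResolventReflection (Φ)
open OneStepResolventKernel (Fib)
open OneStepKernelFamily (KInvStep)
open Summit.QuantumFields.BalabanUV.Beta.HessKerDressedUnits (unitK)
open Summit.QuantumFields.BalabanUV.Beta.GAN24.CombesThomas (UnitDecayK CauchyDecayK ConvCKWall sfStep smStep)
open Summit.QuantumFields.BalabanUV.Beta.FP.PerfectObjects (KTot KInvStep_eq_KTot)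
open Summit.QuantumFields.BalabanUV.Beta.FP.PerfectObjectsT (KPerf)
open Summit.QuantumFields.BalabanUV.Beta.FP.SymmetryK (shiftK_KPerf refK_KPerf decays_KPerf exists_tendsto_of_decays)

noncomputable section

variable {d : ℕ} (Lc : ℕ) [NeZero Lc] (sf sm : ℕ → ℝ)

/-- [our object] **X1m-K AT `m = 1` IS (CONV-C)'s CAUCHY CLAUSE**: `CauchyDecayK d Lc sf sm cK θ δ` with `θ < 1` gives entrywise convergence of the
unit-rescaled (j, 1)-resolvents `unitK (sf j) (sm j) (KTot (Lc^(j+1)) (Lc^j))` (= `unitK … (KInvStep Lc j)` by `rfl`). -/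
theorem exists_tendsto_of_cauchyDecayK {cK θ δ : ℝ} (hKall : CauchyDecayK d Lc sf sm cK θ δ) (hθ1 : θ < 1)
    (x y : Fin (d + 1) → ℤ) (a b : Fib d) :
    ∃ L : ℝ, Tendsto (fun j => unitK (sf j) (sm j) (KTot (d := d) (Lc ^ (j + 1)) (Lc ^ j)) x y a b) atTop (𝓝 L) :=
  exists_tendsto_of_decays (K := fun j => unitK (sf j) (sm j) (KTot (d := d) (Lc ^ (j + 1)) (Lc ^ j))) (fun k j => hKall k j) hθ1 x y a b

/-- [our object] **BLOCK COVARIANCE OF THE PERFECT ONE-STEP RESOLVENT — 0 HYPOTHESES**, blocking written `Lc`: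
`shiftK (−(Lc • t)) (KPerf Lc sf sm 1) = KPerf Lc sf sm 1`. -/
theorem shiftK_KPerf_one (t : Fin (d + 1) → ℤ) :
    shiftK (-((Lc : ℤ) • t)) (KPerf (d := d) Lc sf sm 1) = KPerf Lc sf sm 1 := by
  have h := shiftK_KPerf (d := d) Lc sf sm 1 t
  rwa [pow_one] at h

/-- [our object] **REFLECTION INVARIANCE OF THE PERFECT ONE-STEP RESOLVENT FROM (CONV-C)'s CAUCHY CLAUSE**: for every axis `α`,
`refK (Φ Lc α) (KPerf Lc sf sm 1) = KPerf Lc sf sm 1`. -/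
theorem refK_KPerf_one_of_cauchyDecayK {cK θ δ : ℝ} (hKall : CauchyDecayK d Lc sf sm cK θ δ) (hθ1 : θ < 1) (α : Fin (d + 1)) :
    refK (Φ (d := d) Lc α) (KPerf (d := d) Lc sf sm 1) = KPerf Lc sf sm 1 := by
  have h := refK_KPerf (d := d) Lc sf sm 1 (exists_tendsto_of_cauchyDecayK Lc sf sm hKall hθ1) α
  rwa [pow_one] at h

/-- [our object] **DECAY OF THE PERFECT ONE-STEP RESOLVENT FROM THE K-SLOT**: `UnitDecayK d Lc sf sm C δ` + `CauchyDecayK … cK θ δ′` (`θ < 1`) ⟹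
`Decays (KPerf Lc sf sm 1) C δ` — same constant, same rate. -/
theorem decays_KPerf_one_of_KSlot {C δ cK θ δ' : ℝ} (hK : UnitDecayK d Lc sf sm C δ) (hKall : CauchyDecayK d Lc sf sm cK θ δ') (hθ1 : θ < 1) :
    Decays (KPerf (d := d) Lc sf sm 1) C δ :=
  decays_KPerf (d := d) Lc sf sm 1 (fun j => hK j) (exists_tendsto_of_cauchyDecayK Lc sf sm hKall hθ1)

/-- [our object] **THE THREE KERNEL-SIDE BINDERS OF EVERY K-GENERIC REFLECTION END AT THE PERFECT ONE-STEP RESOLVENT, FROM ROW G-an2-4's K-SLOT**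
(`K := KPerf Lc sf sm 1`, `N := Lc`): `hKd` (∃ decay), `hKs` (block covariance), `hKr` (reflection invariance, every axis) from
`UnitDecayK d Lc sf sm C δ` (`0 < δ`) and `CauchyDecayK d Lc sf sm cK θ δ′` (`θ < 1`). -/
theorem kernelSide_KPerf_one_of_KSlot {C δ cK θ δ' : ℝ} (hδ : 0 < δ) (hK : UnitDecayK d Lc sf sm C δ)
    (hKall : CauchyDecayK d Lc sf sm cK θ δ') (hθ1 : θ < 1) :
    (∃ δ₀ C₀ : ℝ, 0 < δ₀ ∧ 0 ≤ C₀ ∧ Decays (KPerf (d := d) Lc sf sm 1) C₀ δ₀) ∧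
    (∀ t : Fin (d + 1) → ℤ, shiftK (-((Lc : ℤ) • t)) (KPerf (d := d) Lc sf sm 1) = KPerf Lc sf sm 1) ∧
    (∀ α : Fin (d + 1), refK (Φ (d := d) Lc α) (KPerf (d := d) Lc sf sm 1) = KPerf Lc sf sm 1) :=
  ⟨⟨δ, C, hδ, (hK 0).nonneg (Sum.inl 0), decays_KPerf_one_of_KSlot Lc sf sm hK hKall hθ1⟩, shiftK_KPerf_one Lc sf sm,
    refK_KPerf_one_of_cauchyDecayK Lc sf sm hKall hθ1⟩

/-- [our object] **THE SAME FROM THE ∃-PACKAGED WALL FORM OF THE K-SLOT** `ConvCKWall d Lc` (adopted units `(sfStep Lc, smStep d Lc)`). -/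
theorem kernelSide_KPerf_one_of_convCKWall (h : ConvCKWall d Lc) :
    (∃ δ₀ C₀ : ℝ, 0 < δ₀ ∧ 0 ≤ C₀ ∧ Decays (KPerf (d := d) Lc (sfStep Lc) (smStep d Lc) 1) C₀ δ₀) ∧
    (∀ t : Fin (d + 1) → ℤ, shiftK (-((Lc : ℤ) • t)) (KPerf (d := d) Lc (sfStep Lc) (smStep d Lc) 1) = KPerf Lc (sfStep Lc) (smStep d Lc) 1) ∧
    (∀ α : Fin (d + 1), refK (Φ (d := d) Lc α) (KPerf (d := d) Lc (sfStep Lc) (smStep d Lc) 1) = KPerf Lc (sfStep Lc) (smStep d Lc) 1) := by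
  obtain ⟨C, δ, cK, θ, hδ, _hθ0, hθ1, hK, hKall⟩ := h
  exact kernelSide_KPerf_one_of_KSlot Lc (sfStep Lc) (smStep d Lc) hδ hK hKall hθ1

end

end Summit.QuantumFields.BalabanUV.Beta.FP.SymmetryKSlot
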